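import Summits.FinalStateConjecture.FinalStateConjecture.Theorems.BulkKerrCapture.Negative.SpinGapAndMass
import Literature.Barriers.FinalStateConjecture.SlowlyRotatingKerrFrontier

/-!
# `BulkKerrCapture` (stmt-FinalStateConjecture-10696) — negative-side lemmas II: pointwise versus
# uniform in the spin

The crux sits between the barrier family's strongest instance
`Literature.Barriers.FinalStateConjecture.KerrStabilityHoldsBelowNarrow 1` (all `|a| < M`, every
inner radius `r₀ ∈ (r₋, r₊)`, `(ε, C)` pointwise in `(M, a, r₀)`; claimed in preprint by Hintz,
arXiv:2606.28253, Thm. 1.1 / 13.1) taken at the crux's slice `r₀ = M`, and itself: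
`bulkKerrCapture_pointwise` (crux ⇒ `CaptureAt` for each single sub-extremal spin) and
`captureAt_of_kerrStabilityHoldsBelowNarrow_one` (barrier instance ⇒ the same, with `(s, δ, k)`
global). The crux's only content beyond the pointwise statement is the UNIFORMITY of `(ε, C)` on
the compact spin sets `|a| ≤ a₁ M` — unprinted, plausible by continuity of the constants in `a`.
Refuter seat `refuter-cdisprove-stmt-FinalStateConjecture-10696-0`, 2026-08-16; workfile
`Cruxes/BulkKerrCapture/Disproof.lean` §2.
-/

noncomputable section

open Set
open scoped Manifold ENNReal ContDiff

namespace Summit.FinalStateConjecture.FinalStateConjecture.Theorems.BulkKerrCapture.Negative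

open Literature.Geometry.Lorentzian
open Summit.FinalStateConjecture.FinalStateConjecture.Theses.PhaseMixingCapture (BulkKerrCapture)

/-- **Pointwise content of the crux at a single spin.** For every `M > 0` and `|a| < M` the crux
yields exponents, a ball and a constant for that one spin (take `a₁ := |a|/M`). [folklore] -/
theorem bulkKerrCapture_pointwise (h : BulkKerrCapture) [Kerr.Facts] [Kerr.SliceFacts] {M a : ℝ}
    (hM : 0 < M) (ha : Kerr.IsSubextremal M a) :
    ∃ (s : ℕ) (δ : ℝ) (k : ℕ), ∃ ε > (0 : ℝ), ∃ C : ℝ, CaptureAt s δ k M hM.le ε C a := by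
  rw [bulkKerrCapture_iff] at h
  have ha₁ : |a| / M < 1 := by
    rw [div_lt_one hM]
    exact ha
  obtain ⟨s, δ, k, hk⟩ := h (|a| / M) ha₁
  obtain ⟨ε, hε, C, hC⟩ := hk M hM
  have hspin : |a| ≤ |a| / M * M := by rw [div_mul_cancel₀ _ hM.ne']
  exact ⟨s, δ, k, ε, hε, C, hC a hspin⟩

/-- The fixed slice position `r₀ = M` lies strictly between the horizons for every sub-extremal
spin: `r₋ = M − √(M² − a²) < M < M + √(M² − a²) = r₊` (`|a| < M` alone; no separate `0 < M`
needed). [folklore] -/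
theorem mem_Ioo_rMinus_rPlus {M a : ℝ} (ha : Kerr.IsSubextremal M a) :
    M ∈ Ioo (Kerr.rMinus M a) (Kerr.rPlus M a) := by
  unfold Kerr.IsSubextremal at ha
  have hsq : 0 < M ^ 2 - a ^ 2 := by
    have h1 : |a| ^ 2 < M ^ 2 := by
      exact pow_lt_pow_left₀ ha (abs_nonneg a) two_ne_zero
    rw [sq_abs] at h1
    linarith
  have hpos : 0 < √(M ^ 2 - a ^ 2) := Real.sqrt_pos.2 hsq
  simp only [Kerr.rMinus, Kerr.rPlus, mem_Ioo]
  constructor <;> linarith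

/-- **The barrier family's strongest instance gives the crux POINTWISE in the spin, at the crux's
slice `r₀ = M`.** `KerrStabilityHoldsBelowNarrow 1` yields `CaptureAt s δ k M _ ε C a` for each
single sub-extremal spin, with `(s, δ, k)` global but `(ε, C)` depending on `(M, a)`; what the crux
adds is exactly the uniformity of `(ε, C)` on `|a| ≤ a₁ M`. Neither statement formally implies the
other (the crux fixes `r₀ = M`; the barrier instance is pointwise in `a`). [folklore] -/
theorem captureAt_of_kerrStabilityHoldsBelowNarrow_one [Kerr.Facts] [Kerr.SliceFacts]
    (h : Literature.Barriers.FinalStateConjecture.KerrStabilityHoldsBelowNarrow 1) :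
    ∃ (s : ℕ) (δ : ℝ) (k : ℕ), ∀ {M a : ℝ} (hM : 0 < M), Kerr.IsSubextremal M a →
      ∃ ε > (0 : ℝ), ∃ C : ℝ, CaptureAt s δ k M hM.le ε C a := by
  obtain ⟨s, δ, k, hk⟩ := h
  refine ⟨s, δ, k, fun {M a} hM ha ↦ ?_⟩
  have ha' : |a| < 1 * M := by
    rw [one_mul]
    exact ha
  obtain ⟨ε, hε, C, hC⟩ := hk M a hM ha' M (mem_Ioo_rMinus_rPlus ha)
  exact ⟨ε, hε, C, hC⟩

end Summit.FinalStateConjecture.FinalStateConjecture.Theorems.BulkKerrCapture.Negative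

end
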